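import Summits.AnomalousDissipation.AnomalousDissipation.Theorems.QuasiStaticSolenoidalCellTensorQ.Negative.NominalLawFailsAtDesignWord
import HarnessLib

/-!
# Kernel check: the registered stub `stub_gainFamily` of crux K2Q is FALSE

Crux `QuasiStaticSolenoidalCellTensorQ` (stmt-AnomalousDissipation-19072, route `SolenoidalFractalHomogenisation`, aside since
rev 5), birth skeleton `QuasiStaticSolenoidalCellTensorQ_birth-route.lean` (sha 3adcaa7f407e6dc5, planner-ad-ideate-p1-g3,
2026-08-26): stubs `stub_isotropicDesign` (LANDED p446420) and `stub_gainFamily` (open, "active").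

The signature registered for `stub_gainFamily` is, byte for byte, the proposition negated by the landed tree theorem
`Summit.AnomalousDissipation.AnomalousDissipation.Theorems.QuasiStaticSolenoidalCellTensorQ.Negative.not_forall_isotropic_nominalGain`
(file `Theorems/QuasiStaticSolenoidalCellTensorQ/Negative/NominalLawFailsAtDesignWord.lean`, p729753, standard axioms).
The theorem below restates the stub's signature VERBATIM under `¬` and closes it by that name: the stub is dead, hence the
birth line (whose composition `QuasiStaticSolenoidalCellTensorQ_of` needs it) is dead.  Evidence file only (prover
leafhand-ad-solenoidalfractalh-2 g0, 2026-08-30); nothing here is proposed to `Theorems/`.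
-/

set_option linter.dupNamespace false

namespace Summit.AnomalousDissipation.AnomalousDissipation.Cruxes.QuasiStaticSolenoidalCellTensorQ.Birth

open Literature.Analysis Literature.Analysis.FluidPDE

/-- `¬ (signature of stub_gainFamily)`, by the landed negative lemma `not_forall_isotropic_nominalGain`. -/
theorem stub_gainFamily_false :
    ¬ (∀ k (W : LatticeShear.LatticeWord k) (c₀ : ℝ), 0 < c₀ → LatticeShear.IsotropicWordGain W c₀ →
        ∀ c, 0 < c → c < c₀ → ∃ ν₀ > (0:ℝ), ∃ K > (0:ℝ), LatticeShear.WordGainAtRate W c ν₀ K 1) :=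
  Summit.AnomalousDissipation.AnomalousDissipation.Theorems.QuasiStaticSolenoidalCellTensorQ.Negative.not_forall_isotropic_nominalGain

end Summit.AnomalousDissipation.AnomalousDissipation.Cruxes.QuasiStaticSolenoidalCellTensorQ.Birth
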